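import Mathlib

/-!
# Sketch — crux-ideate round 1, ideator 1, crux `StableConeRPRigidity` (stmt-CriticalPhenomena-4800)

First lemmas of three idea cards (signatures only; `lean check` must elaborate, nothing is proved):

* `ThreeMirrorAnalyticity`  (card `cross-theorem-analyticity`): reflection positivity + mirror
  invariance in the three COORDINATE mirrors already make a continuous even kernel real-analytic on
  the open octant (Widder–Devinatz Laplace–Fourier representation in each normal variable ⇒
  separate holomorphy on the cross ((0,∞) ⊂ {Re > 0})³ ⇒ joint holomorphy by the
  Bernstein–Siciak–Zahariuta cross theorem).  `NineMirrorAnalyticity` is the corollary the crux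
  uses: with all nine lattice mirrors the kernel is real-analytic on `ℝ³ ∖ {0}`.
* `RPDescendsToLevyMeasure` (card `levy-side-linearisation`): for a kernel in the stable cone,
  reflection positivity of the POTENTIAL kernel `K` in a mirror `n` forces reflection positivity of
  the LÉVY kernel `J_Φ(z) = ‖z‖^{-(3+α)} Φ(z/‖z‖)` in the same mirror (where `Φ` appears nakedly).
* `AxialFibreFourLineRP` (card `axial-fibre-planar-reduction`): the four mirrors containing the
  `x₃`-axis survive the partial Fourier transform along that axis: every cosine fibre
  `k_q(y) = ∫ K(y₁,y₂,s) cos(q s) ds` is a planar kernel reflection positive in the four lines of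
  the square lattice (axes and diagonals).
-/

namespace Summit.CriticalPhenomena.Ising3DConformalLimit.Cruxes.StableConeRPRigidity.Sketch

open scoped BigOperators Topology Classical MeasureTheory Matrix InnerProductSpace
open Filter Set Function MeasureTheory

/-- shorthand: `E3 = ℝ³`, `E2 = ℝ²` as Euclidean spaces -/
abbrev E3 := EuclideanSpace ℝ (Fin 3)
abbrev E2 := EuclideanSpace ℝ (Fin 2)

/-- Reflection positivity of a translation-invariant kernel `K` with respect to the mirror with
normal `n` (finite configurations strictly inside the open half-space `{x | ⟪x,n⟫ > 0}`), exactly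
as in the crux. -/
def IsRP {ι : Type} [Fintype ι] (K : EuclideanSpace ℝ ι → ℝ) (n : EuclideanSpace ℝ ι) : Prop :=
  ∀ (m : ℕ) (p : Fin m → EuclideanSpace ℝ ι) (c : Fin m → ℝ), (∀ a, 0 < inner ℝ (p a) n) →
    0 ≤ ∑ a, ∑ b, c a * c b * K (p a - ((ℝ ∙ n)ᗮ).reflection (p b))

/-- Mirror invariance `K ∘ θ_n = K`. -/
def IsMirrorInvariant {ι : Type} [Fintype ι] (K : EuclideanSpace ℝ ι → ℝ)
    (n : EuclideanSpace ℝ ι) : Prop :=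
  ∀ x, K (((ℝ ∙ n)ᗮ).reflection x) = K x

/-- The nine lattice mirror normals of `ℤ³`: `eᵢ`, `eᵢ + eⱼ`, `eᵢ − eⱼ`. -/
def IsLatticeMirror (n : E3) : Prop :=
  ∃ i j : Fin 3, i ≠ j ∧ (n = EuclideanSpace.single i 1 ∨
    n = EuclideanSpace.single i 1 + EuclideanSpace.single j 1 ∨
    n = EuclideanSpace.single i 1 - EuclideanSpace.single j 1)

/-- FIRST LEMMA of card `cross-theorem-analyticity` (general; no stable cone, no homogeneity):
a continuous even kernel on `ℝ³ ∖ 0` that is mirror-invariant and reflection positive for the three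
coordinate mirrors is real-analytic on the open positive octant.  (Per mirror, Widder–Devinatz:
`K(t,x') = ∫ e^{-tλ} e^{i q·x'} dμ(λ,q)` for `t > 0`, so `t ↦ K` is holomorphic on `Re t > 0` for
every real `x'`; three mirrors = separate holomorphy on the cross `((0,∞) ⊂ {Re>0})³`; the
Bernstein–Siciak–Zahariuta cross theorem gives joint holomorphy on `{Σ |arg zⱼ| < π/2} ⊃ (0,∞)³`.) -/
def ThreeMirrorAnalyticity : Prop :=
  ∀ K : E3 → ℝ, ContinuousOn K {0}ᶜ → (∀ x, K (-x) = K x) →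
    (∀ i : Fin 3, IsMirrorInvariant K (EuclideanSpace.single i 1) ∧
      IsRP K (EuclideanSpace.single i 1)) →
    AnalyticOnNhd ℝ K {x : E3 | ∀ i, 0 < x i}

/-- Corollary used on the crux: with all nine lattice mirrors every `x ≠ 0` has three linearly
independent mirror normals `nᵢ` with `⟪x,nᵢ⟫ ≠ 0`, so `K` is real-analytic on `ℝ³ ∖ {0}`; for a
homogeneous `K = ‖x‖^{α-3} U(x/‖x‖)` this is real-analyticity of the angular profile `U` on `S²`,
and (via `RPDescendsToLevyMeasure`, applied to `J_Φ` instead of `K`) of `Φ` itself. -/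
def NineMirrorAnalyticity : Prop :=
  ∀ K : E3 → ℝ, ContinuousOn K {0}ᶜ → (∀ x, K (-x) = K x) →
    (∀ n : E3, IsLatticeMirror n → IsMirrorInvariant K n ∧ IsRP K n) →
    AnalyticOnNhd ℝ K {0}ᶜ

/-- The Lévy-side kernel of the stable cone: `J_Φ(z) = ‖z‖^{-(3+α)} Φ(z/‖z‖)` (the density of the
Lévy measure of the symmetric `α`-stable law with angular density `Φ`). -/
noncomputable def levyKernel (α : ℝ) (Φ : E3 → ℝ) (z : E3) : ℝ :=
  ‖z‖ ^ (-(3 + α)) * Φ (‖z‖⁻¹ • z)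

/-- FIRST LEMMA of card `levy-side-linearisation`: RP DESCENDS FROM THE POTENTIAL KERNEL TO THE
LÉVY KERNEL.  Hypotheses on `(α, Φ, K)` verbatim from the crux, but for ONE mirror normal `n ≠ 0`
(any direction): if `K` is `θ_n`-invariant and reflection positive, so is `J_Φ`.  (Fourier side:
RP_n(K) ⇔ `s ↦ ψ_Φ(√s n + q)` complete Bernstein for a.e. `q ⊥ n`, with no linear term since
`α < 2`; then `Ĵ_Φ = −ψ_Φ` (Lévy–Khintchine, distributionally) has Stieltjes sections modulo
constants, i.e. the transverse Fourier transform of `J_Φ(t,·)` is completely monotone in `t > 0`,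
i.e. RP_n(J_Φ).  The converse also holds.) -/
def RPDescendsToLevyMeasure : Prop :=
  ∀ (α : ℝ) (Φ K : E3 → ℝ) (n : E3), 1 ≤ α → α < 2 → n ≠ 0 →
    ContinuousOn Φ (Metric.sphere 0 1) → (∀ u ∈ Metric.sphere (0 : E3) 1, 0 ≤ Φ u) →
    (∀ u, Φ (-u) = Φ u) → ContinuousOn K {0}ᶜ → (∀ x, x ≠ 0 → 0 < K x) →
    (∀ c : ℝ, 0 < c → ∀ x, K (c • x) = c ^ (α - 3) * K x) →
    (∀ f : E3 → ℝ, ContDiff ℝ 2 f → HasCompactSupport f → ∀ x,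
      (∫ y, K (x - y) * ((1/2 : ℝ) * ∫ z, (f (y + z) + f (y - z) - 2 * f y) *
        (‖z‖ ^ (-(3 + α)) * Φ (‖z‖⁻¹ • z)))) = - f x) →
    IsMirrorInvariant K n → IsRP K n →
    IsRP (levyKernel α Φ) n

/-- Embedding of a planar point `y` at height `s` along the `x₃`-axis. -/
noncomputable def lift (y : E2) (s : ℝ) : E3 :=
  (WithLp.equiv 2 (Fin 3 → ℝ)).symm ![y 0, y 1, s]

/-- The cosine fibre of `K` at axial momentum `q`: `k_q(y) = ∫ K(y₁,y₂,s) cos(q s) ds`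
(partial Fourier transform along the common axis of the four mirrors `x₁=0, x₂=0, x₁=±x₂`). -/
noncomputable def axialFibre (K : E3 → ℝ) (q : ℝ) (y : E2) : ℝ :=
  ∫ s : ℝ, K (lift y s) * Real.cos (q * s)

/-- The four line normals of the square lattice in the `(x₁,x₂)`-plane. -/
def IsSquareLatticeLine (ℓ : E2) : Prop :=
  ℓ = EuclideanSpace.single 0 1 ∨ ℓ = EuclideanSpace.single 1 1 ∨
    ℓ = EuclideanSpace.single 0 1 + EuclideanSpace.single 1 1 ∨
    ℓ = EuclideanSpace.single 0 1 - EuclideanSpace.single 1 1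

/-- FIRST LEMMA of card `axial-fibre-planar-reduction` (general: continuity, evenness and
integrability along the axis suffice): reflection positivity and invariance for the four mirrors
that contain the `x₃`-axis pass to EVERY cosine fibre `k_q`, which is then a planar kernel
reflection positive (and mirror-invariant) in the four lines of the square lattice.  (Proof idea:
apply RP to configurations `(p_a, s_j)` with weights `c_a w_j cos(q s_j)` and `c_a w_j sin(q s_j)`,
add, and let the Riemann grid `s_j` exhaust `ℝ`; the reflections do not move the `x₃`-coordinate.)
For the crux (`K` homogeneous of degree `α − 3`, `α < 2`) integrability holds at every `y ≠ 0`,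
`k_q(y) = |q|^{2-α} k_1(|q| y)` for `q ≠ 0`, and `k_0 = ∫ K ds` is homogeneous of degree `α − 2`:
a PLANAR stable-cone kernel. -/
def AxialFibreFourLineRP : Prop :=
  ∀ K : E3 → ℝ, ContinuousOn K {0}ᶜ → (∀ x, K (-x) = K x) →
    (∀ y : E2, y ≠ 0 → Integrable (fun s : ℝ => K (lift y s))) →
    (∀ n : E3, (n = EuclideanSpace.single 0 1 ∨ n = EuclideanSpace.single 1 1 ∨
        n = EuclideanSpace.single 0 1 + EuclideanSpace.single 1 1 ∨
        n = EuclideanSpace.single 0 1 - EuclideanSpace.single 1 1) →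
      IsMirrorInvariant K n ∧ IsRP K n) →
    ∀ q : ℝ, ∀ ℓ : E2, IsSquareLatticeLine ℓ →
      IsMirrorInvariant (axialFibre K q) ℓ ∧ IsRP (axialFibre K q) ℓ

/-- How the planar reduction reassembles (recorded, elementary): if for each of the three coordinate
axes every fibre is radial in its plane, `K` is invariant under the rotations about all three axes,
which generate `SO(3)`; with evenness, under `O(3)`.  Stated for the `x₃`-axis as the implication
"all fibres radial ⇒ `K` invariant under rotations fixing `e₃`". -/
def FibrewiseRadialGivesAxialSymmetry : Prop :=
  ∀ K : E3 → ℝ, ContinuousOn K {0}ᶜ →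
    (∀ y : E2, y ≠ 0 → Integrable (fun s : ℝ => K (lift y s))) →
    (∀ x : E3, K ((WithLp.equiv 2 (Fin 3 → ℝ)).symm ![x 0, x 1, -(x 2)]) = K x) →
    (∀ (q : ℝ) (R : E2 ≃ₗᵢ[ℝ] E2) (y : E2), axialFibre K q (R y) = axialFibre K q y) →
    ∀ (R : E2 ≃ₗᵢ[ℝ] E2) (y : E2) (s : ℝ), K (lift (R y) s) = K (lift y s)


/-! ### Card `entire-profile-null-growth` (lead card)

On a plane through the origin containing two mirror normals that are neither parallel nor
perpendicular, the two families of reflection positivities make the ANGULAR PROFILE of a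
homogeneous kernel an ENTIRE function of the complexified polar angle (two overlapping strips of
holomorphy + dihedral periodicity), and positivity of the Laplace–Fourier measure caps its growth by
`e^{β |Im ω|}` (`β` = minus the degree); Cauchy estimates then kill every Fourier mode `e^{i k m ω}`
with `k m > β` (`k = 4` on coordinate planes, `k = 6` on the planes `x ± y ± z = 0`).  Two checkable
consequences: -/

/-- PLANAR FOUR-LINE RIGIDITY (the `d = 2` shadow of the crux, claimed PROVABLE by the lever): a
continuous, positive, even kernel on `ℝ² ∖ 0`, homogeneous of degree `-β` with `0 < β < 4`, that is
mirror-invariant and reflection positive in the four lines of the square lattice (`x₁ = 0`, `x₂ = 0`,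
`x₁ = ± x₂`) is radial.  The planar stable cone is `β = 2 - α ∈ (0, 2)`. -/
def PlanarFourLineRigidity : Prop :=
  ∀ (β : ℝ) (k : E2 → ℝ), 0 < β → β < 4 → ContinuousOn k {0}ᶜ → (∀ y, y ≠ 0 → 0 < k y) →
    (∀ y, k (-y) = k y) → (∀ c : ℝ, 0 < c → ∀ y, k (c • y) = c ^ (-β) * k y) →
    (∀ ℓ : E2, IsSquareLatticeLine ℓ → IsMirrorInvariant k ℓ ∧ IsRP k ℓ) →
    ∀ (R : E2 ≃ₗᵢ[ℝ] E2) (y : E2), k (R y) = k y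

/-- FIRST LEMMA of the lead card in `d = 3` (COORDINATE-PLANE ISOTROPY, the first rung of the
"seven-circle web"): a continuous positive even kernel on `ℝ³ ∖ 0`, homogeneous of degree `-β`,
`0 < β < 4`, mirror-invariant and reflection positive in the nine lattice mirrors, is invariant under
every isometry fixing `e₃` when restricted to the plane `x₃ = 0` (and likewise for the other two
coordinate planes and — with `6m > β` — for the four planes `x ± y ± z = 0`).  For the crux
`β = 3 - α ∈ (1, 2]`. -/
def CoordinatePlaneIsotropy : Prop :=
  ∀ (β : ℝ) (K : E3 → ℝ), 0 < β → β < 4 → ContinuousOn K {0}ᶜ → (∀ x, x ≠ 0 → 0 < K x) →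
    (∀ x, K (-x) = K x) → (∀ c : ℝ, 0 < c → ∀ x, K (c • x) = c ^ (-β) * K x) →
    (∀ n : E3, IsLatticeMirror n → IsMirrorInvariant K n ∧ IsRP K n) →
    ∀ (R : E3 ≃ₗᵢ[ℝ] E3), R (EuclideanSpace.single 2 1) = EuclideanSpace.single 2 1 →
      ∀ x : E3, x 2 = 0 → K (R x) = K x

/-- TRANSFER of the lead card (the statement `(E₉)` it reduces the crux to, in its checkable
one-variable form): for EVERY mirror normal `n` and EVERY unit `u ⊥ n` the profile
`ω ↦ K (cos ω • u + sin ω • n)` is the restriction of an entire function of exponential type `≤ β`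
in `|Im ω|`.  (On the seven web planes this is what the lever proves; `(E₉)` asks it on all great
circles through a normal — an envelope-of-holomorphy statement for the nine-slab configuration.
Given `(E₉)`, mode extinction `2m > β = 3 - α` on every such circle, plus `O_h` for the `m = 1`
mode at `α = 1`, gives the crux.) -/
def NineSlabEntireProfiles : Prop :=
  ∀ (β : ℝ) (K : E3 → ℝ), 0 < β → β < 4 → ContinuousOn K {0}ᶜ → (∀ x, x ≠ 0 → 0 < K x) →
    (∀ x, K (-x) = K x) → (∀ c : ℝ, 0 < c → ∀ x, K (c • x) = c ^ (-β) * K x) →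
    (∀ n : E3, IsLatticeMirror n → IsMirrorInvariant K n ∧ IsRP K n) →
    ∀ (n u : E3), IsLatticeMirror n → inner ℝ u n = 0 → ‖u‖ = 1 →
      ∃ g : ℂ → ℂ, Differentiable ℂ g ∧
        (∀ ω : ℝ, g ω = (K (Real.cos ω • u + Real.sin ω • (‖n‖⁻¹ • n)) : ℂ)) ∧
        ∃ C : ℝ, ∀ ω : ℂ, ‖g ω‖ ≤ C * Real.exp (β * |ω.im|)

end Summit.CriticalPhenomena.Ising3DConformalLimit.Cruxes.StableConeRPRigidity.Sketch
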